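import Summits.QuantumFields.YangMills.Theorems.SmallCircleAnchorAnchorGapStubDebyeScreening9

/-!
# Crux `AnchorGap` (stmt-QuantumFields-11141), line `registered` — DSred reduced to flat-reference clustering

Stub DSred (`stub_debyeScreening`, reduced form; skeleton `Cruxes/AnchorGap/Lines/birth.lean`) is
Debye screening of the `k`-component lattice sine-Gordon gas on the discrete three-torus with the
regulator removed at fixed volume (`∀ N, ∃ ε₀(N)`).  With the soft step M-c closed
(`expect_sub_flatExpect_le`, `…StubDebyeScreening9`), this file performs the reduction:

* `integral_indicator_flatWeight_pos`, `abs_flatExpect_le` — the flat reference ensemble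
  `⟨H⟩^flat = ∫ 1_S H W / ∫ 1_S W` (`S = {θ̄ ∈ D_b}` the zero-mode cell of the commensurate dual
  basis `b`, `W = exp(−(2g²)⁻¹[‖∇φ‖² + ε‖φ − θ̄‖²] + tilt)`) is non-degenerate and its expectations of
  `|H| ≤ 1` are bounded by `1`;
* `stub_debyeScreening_of_flat` — **DSred ⟸ (X_flat)**: exponential clustering of admissible
  observables in the flat reference ensemble, with the same quantifier structure as DSred but the
  basis `b` universally quantified, implies DSred with constants `(2 max C 1, c, n₀)`; at fixed `N`
  the regulator threshold is shrunk below `a₀(k, b, δ_N) g₁² / N³`, `δ_N = min 1 ((max C 1/4) e^{−cN/2})`.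

The hypothesis (X_flat) is the honest remaining core of DSred — the Brydges 1978 / Brydges–Federbush
cluster expansion for the neutral vector Coulomb gas with compact zero mode, uniform in the period —
and is equivalent to DSred by the same comparison (constants `C ↦ 2 max C 1`).
-/

set_option autoImplicit false

noncomputable section

namespace Summit.QuantumFields.YangMills.Theorems.AnchorGap

open MeasureTheory Finset
open Literature.Probability.LatticeModels

/-- **The flat reference ensemble is non-degenerate**: `∫ 1_{D_b}(θ̄) W > 0` (`g ≠ 0`, `ε > 0`).
The zero-mode cell contains the open non-empty set `{φ | all b-coordinates of θ̄(φ) lie in (0,1)}`,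
which has positive Lebesgue measure, and `W > 0`. [folklore] -/
theorem integral_indicator_flatWeight_pos :
    ∀ (d N k : ℕ) [NeZero N] (ι : Type) [Fintype ι] (α : ι → Fin k → ℝ) (b : Fin k → Fin k → ℝ), LinearIndependent ℝ b → ∀ (g ε ζ : ℝ), g ≠ 0 → 0 < ε → 0 < ∫ φ : LatticeSineGordon.Config d N k, {φ : LatticeSineGordon.Config d N k | ∃ t : Fin k → ℝ, (∀ j : Fin k, 0 ≤ t j ∧ t j < 1) ∧ ∀ a : Fin k, (Fintype.card (TorusSite d N) : ℝ)⁻¹ * ∑ x : TorusSite d N, φ (x, a) = ∑ j : Fin k, t j * b j a}.indicator (fun φ => LatticeSineGordon.weight α g ε ζ φ * Real.exp ((2 * g ^ 2)⁻¹ * (ε * ((Fintype.card (TorusSite d N) : ℝ)⁻¹ * ∑ a : Fin k, (∑ x : TorusSite d N, φ (x, a)) ^ 2)))) φ := by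
  intro d N k _ ι _ α b hb g ε ζ hg hε
  classical
  set S : Set (LatticeSineGordon.Config d N k) := {φ | ∃ t : Fin k → ℝ, (∀ j : Fin k, 0 ≤ t j ∧ t j < 1) ∧
    ∀ a : Fin k, (Fintype.card (TorusSite d N) : ℝ)⁻¹ * ∑ x : TorusSite d N, φ (x, a) = ∑ j : Fin k, t j * b j a} with hS
  set V : ℝ := (Fintype.card (TorusSite d N) : ℝ) with hV
  have hVpos : 0 < V := by
    rw [hV]; exact_mod_cast Fintype.card_pos
  let B := basisOfPiSpaceOfLinearIndependent hb
  have hB : ⇑B = b := coe_basisOfPiSpaceOfLinearIndependent hb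
  set θb : LatticeSineGordon.Config d N k → Fin k → ℝ := fun φ c => V⁻¹ * ∑ x, φ (x, c) with hθb
  -- an open non-empty subset of the cell
  set U : Set (LatticeSineGordon.Config d N k) :=
    (fun φ => B.equivFun (θb φ)) ⁻¹' Set.pi Set.univ (fun _ : Fin k => Set.Ioo (0 : ℝ) 1) with hU
  have hUS : U ⊆ S := by
    intro φ hφ
    simp only [hU, Set.mem_preimage, Set.mem_pi, Set.mem_univ, forall_true_left, Set.mem_Ioo,
      Module.Basis.equivFun_apply] at hφ
    refine ⟨fun j => B.repr (θb φ) j, fun j => ⟨(hφ j).1.le, (hφ j).2⟩, fun a => ?_⟩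
    show θb φ a = _
    conv_lhs => rw [← B.sum_repr (θb φ)]
    rw [Finset.sum_apply]
    simp [hB, smul_eq_mul]
  have hθb_cont : Continuous θb := by
    rw [hθb]; fun_prop
  have hUopen : IsOpen U := by
    refine IsOpen.preimage ?_ (isOpen_set_pi Set.finite_univ fun _ _ => isOpen_Ioo)
    exact (LinearMap.continuous_of_finiteDimensional (B.equivFun : (Fin k → ℝ) →ₗ[ℝ] Fin k → ℝ)).comp
      hθb_cont
  have hUne : U.Nonempty := by
    refine ⟨fun p => (∑ j, (1 / 2 : ℝ) • B j) p.2, ?_⟩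
    simp only [hU, Set.mem_preimage, Set.mem_pi, Set.mem_univ, forall_true_left, Set.mem_Ioo,
      Module.Basis.equivFun_apply]
    intro i
    have hθ : θb (fun p => (∑ j, (1 / 2 : ℝ) • B j) p.2) = ∑ j, (1 / 2 : ℝ) • B j := by
      funext c
      simp only [hθb, sum_const, card_univ, nsmul_eq_mul]
      rw [← hV]
      field_simp
    rw [hθ, Module.Basis.repr_sum_self]
    norm_num
  have hUpos : 0 < volume U := hUopen.measure_pos volume hUne
  -- positivity of the integral
  have hint := integrable_indicator_flatWeight d N k ι α b hb g ε ζ hg hε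
  have hWpos : ∀ φ : LatticeSineGordon.Config d N k, 0 < LatticeSineGordon.weight α g ε ζ φ *
      Real.exp ((2 * g ^ 2)⁻¹ * (ε * (V⁻¹ * ∑ a : Fin k, (∑ x : TorusSite d N, φ (x, a)) ^ 2))) :=
    fun φ => mul_pos (LatticeSineGordon.weight_pos _ _ _ _ _) (Real.exp_pos _)
  rw [integral_pos_iff_support_of_nonneg (fun φ => Set.indicator_nonneg (fun ψ _ => (hWpos ψ).le) φ) hint,
    Set.support_indicator]
  have hsupp : Function.support (fun φ : LatticeSineGordon.Config d N k => LatticeSineGordon.weight α g ε ζ φ *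
      Real.exp ((2 * g ^ 2)⁻¹ * (ε * (V⁻¹ * ∑ a : Fin k, (∑ x : TorusSite d N, φ (x, a)) ^ 2)))) = Set.univ :=
    Set.eq_univ_of_forall fun φ => (hWpos φ).ne'
  rw [hsupp, Set.inter_univ]
  exact lt_of_lt_of_le hUpos (measure_mono hUS)

/-- **Flat reference expectations of bounded observables are bounded**: for measurable `|H| ≤ 1`,
`|∫ 1_S H W / ∫ 1_S W| ≤ 1` (`g ≠ 0`, `ε > 0`). [folklore] -/
theorem abs_flatExpect_le :
    ∀ (d N k : ℕ) [NeZero N] (ι : Type) [Fintype ι] (α : ι → Fin k → ℝ) (b : Fin k → Fin k → ℝ), LinearIndependent ℝ b → ∀ (g ε ζ : ℝ), g ≠ 0 → 0 < ε → ∀ (H : LatticeSineGordon.Config d N k → ℝ), Measurable H → (∀ φ, |H φ| ≤ 1) → let S : Set (LatticeSineGordon.Config d N k) := {φ | ∃ t : Fin k → ℝ, (∀ j : Fin k, 0 ≤ t j ∧ t j < 1) ∧ ∀ a : Fin k, (Fintype.card (TorusSite d N) : ℝ)⁻¹ * ∑ x : TorusSite d N, φ (x, a) = ∑ j : Fin k,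 t j * b j a}; let W : LatticeSineGordon.Config d N k → ℝ := fun φ => LatticeSineGordon.weight α g ε ζ φ * Real.exp ((2 * g ^ 2)⁻¹ * (ε * ((Fintype.card (TorusSite d N) : ℝ)⁻¹ * ∑ a : Fin k, (∑ x : TorusSite d N, φ (x, a)) ^ 2))); |(∫ φ, S.indicator (fun φ => H φ * W φ) φ) / ∫ φ, S.indicator W φ| ≤ 1 := by
  intro d N k _ ι _ α b hb g ε ζ hg hε H hHm hH1 S W
  have hZ : 0 < ∫ φ, S.indicator W φ := integral_indicator_flatWeight_pos d N k ι α b hb g ε ζ hg hε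
  have hint : Integrable (S.indicator W) := integrable_indicator_flatWeight d N k ι α b hb g ε ζ hg hε
  have hWpos : ∀ φ, 0 < W φ := fun φ => mul_pos (LatticeSineGordon.weight_pos _ _ _ _ _) (Real.exp_pos _)
  have hf₀nn : ∀ φ, 0 ≤ S.indicator W φ := fun φ => Set.indicator_nonneg (fun ψ _ => (hWpos ψ).le) φ
  have heq : ∀ φ, S.indicator (fun φ => H φ * W φ) φ = H φ * S.indicator W φ := fun φ =>
    Set.indicator_mul_right S H W
  simp_rw [heq]
  have hHn : ∀ᵐ φ ∂(volume : Measure (LatticeSineGordon.Config d N k)), ‖H φ‖ ≤ 1 :=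
    Filter.Eventually.of_forall fun φ => by rw [Real.norm_eq_abs]; exact hH1 φ
  have hiH : Integrable (fun φ => H φ * S.indicator W φ) := hint.bdd_mul hHm.aestronglyMeasurable hHn
  rw [abs_div, abs_of_pos hZ, div_le_one hZ]
  calc |∫ φ, H φ * S.indicator W φ| ≤ ∫ φ, |H φ * S.indicator W φ| := abs_integral_le_integral_abs
    _ ≤ ∫ φ, S.indicator W φ := integral_mono hiH.abs hint fun φ => by
        simp only []
        rw [abs_mul, abs_of_nonneg (hf₀nn φ)]
        exact mul_le_of_le_one_left (hf₀nn φ) (hH1 φ)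

/-- Bookkeeping for `stub_debyeScreening_of_flat`: three `δ`-comparisons of expectations, the
flat clustering bound `K` and `|⟨F⟩|, |⟨G⟩| ≤ 1` give `|⟨FG⟩ − ⟨F⟩⟨G⟩| ≤ K + 3δ + δ² ≤ 2B`. -/
private lemma glue_arith (EFG EF EG PFG PF PG δ K B : ℝ) (h1 : |EFG - PFG| ≤ δ)
    (h2 : |EF - PF| ≤ δ) (h3 : |EG - PG| ≤ δ) (hEF : |EF| ≤ 1) (hEG : |EG| ≤ 1)
    (hK : |PFG - PF * PG| ≤ K) (hδ0 : 0 ≤ δ) (hδ1 : δ ≤ 1) (hKB : K ≤ B) (h4 : 4 * δ ≤ B) :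
    |EFG - EF * EG| ≤ 2 * B := by
  have h2' : |PF - EF| ≤ δ := by rwa [abs_sub_comm] at h2
  have h3' : |PG - EG| ≤ δ := by rwa [abs_sub_comm] at h3
  have hPG : |PG| ≤ 1 + δ := by
    have := abs_sub_abs_le_abs_sub PG EG
    linarith
  have hdec : EFG - EF * EG =
      (EFG - PFG) + (PFG - PF * PG) + ((PF - EF) * PG + EF * (PG - EG)) := by ring
  rw [hdec]
  have t1 : |(PF - EF) * PG| ≤ δ * (1 + δ) := by
    rw [abs_mul]; exact mul_le_mul h2' hPG (abs_nonneg _) hδ0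
  have t2 : |EF * (PG - EG)| ≤ 1 * δ := by
    rw [abs_mul]; exact mul_le_mul hEF h3' (abs_nonneg _) zero_le_one
  calc |(EFG - PFG) + (PFG - PF * PG) + ((PF - EF) * PG + EF * (PG - EG))|
      ≤ |EFG - PFG| + |PFG - PF * PG| + |(PF - EF) * PG + EF * (PG - EG)| := abs_add_three _ _ _
    _ ≤ δ + K + (δ * (1 + δ) + 1 * δ) :=
        add_le_add (add_le_add h1 hK) ((abs_add_le _ _).trans (add_le_add t1 t2))
    _ ≤ 2 * B := by nlinarith

/-- **DSred follows from flat-reference clustering.** If the truncated correlations of admissible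
observables cluster exponentially, uniformly in the volume, in the FLAT reference ensemble
`⟨H⟩^flat = ∫ 1_S H W / ∫ 1_S W` (zero mode confined to the fundamental cell `D_b` of the commensurate
dual basis `b` with flat prior, mass `ε ≤ ε₀(N)` on the non-constant modes: the neutral gas with
compact zero mode), then stub DSred (`stub_debyeScreening`, reduced form) holds with constants
`2 max C 1, c, n₀`: at fixed `N` choose `δ_N = min 1 ((max C 1 / 4) e^{−cN/2})`, shrink `ε₀(N)` below
`a₀(k, b, δ_N) g₁² / N³` (`expect_sub_flatExpect_le`), and use
`|truncCorr_ε − truncCorr^flat| ≤ 3δ_N + δ_N² ≤ (max C 1) e^{−cn}` for `2n < N` (admissible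
observables, their translates and products are measurable, bounded by `1` and invariant under the
constant dual shifts, `obs_add_dual`).  The converse implication holds by the same estimate, so the
hypothesis is the honest remaining core of DSred (the Brydges-type expansion, uniform in `N`). [folklore] -/
theorem stub_debyeScreening_of_flat :
    (∀ (k M : ℕ) (α : Fin M → Fin k → ℝ), (∀ v : Fin k → ℝ, (∀ r : Fin M, ∑ a : Fin k, α r a * v a = 0) → v = 0) → ∀ (b : Fin k → Fin k → ℝ), LinearIndependent ℝ b → (∀ (j : Fin k) (r : Fin M), ∃ z : ℤ, ∑ a : Fin k, α r a * b j a = 2 * Real.pi * z) → ∀ g₁ g₂ : ℝ, 0 < g₁ → g₁ ≤ g₂ → ∃ ζ₀ : ℝ, 0 < ζ₀ ∧ ∀ ζ₁ : ℝ, 0 < ζ₁ → ζ₁ ≤ ζ₀ → ∀ R₀ : ℕ, ∃ C c : ℝ, 0 < c ∧ ∃ n₀ : ℕ, ∀ (N : ℕ) [NeZero N], ∃ ε₀ : ℝ, 0 < ε₀ ∧ ∀ g ζ ε : ℝ, g₁ ≤ g → g ≤ g₂ → ζ₁ ≤ ζ → ζ ≤ ζ₀ → 0 < ε → ε ≤ ε₀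 → let Obs := fun F : LatticeSineGordon.Config 3 N k → ℝ => Measurable F ∧ (∀ φ, |F φ| ≤ 1) ∧ (∀ φ ψ : LatticeSineGordon.Config 3 N k, (∀ x : TorusSite 3 N, (∀ i : Fin 3, (x i).val ≤ R₀) → ∀ a : Fin k, φ (x, a) = ψ (x, a)) → F φ = F ψ) ∧ (∀ (φ : LatticeSineGordon.Config 3 N k) (x : TorusSite 3 N) (w : Fin k → ℝ), (∀ r : Fin M, ∃ z : ℤ, ∑ a : Fin k, α r a * w a = 2 * Real.pi * z) → F (fun p => if p.1 = x then φ p + w p.2 else φ p) = F φ); let S : Set (LatticeSineGordon.Config 3 N k) := {φ | ∃ t : Fin k → ℝ, (∀ j : Fin k, 0 ≤ t j ∧ t j < 1) ∧ ∀ a : Fin k, (Fintype.card (TorusSite 3 N) : ℝ)⁻¹ * ∑ x : TorusSite 3 N, φ (x, a) = ∑ j : Fin k, t j * b j a}; let W : LatticeSineGordon.Config 3 N k → ℝ := fun φ => LatticeSineGordon.weight α g ε ζ φ * Real.exp ((2 * g ^ 2)⁻¹ * (ε * ((Fintype.card (TorusSite 3 N) : ℝ)⁻¹ * ∑ a : Fin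 k, (∑ x : TorusSite 3 N, φ (x, a)) ^ 2))); let Ef := fun H : LatticeSineGordon.Config 3 N k → ℝ => (∫ φ, S.indicator (fun φ => H φ * W φ) φ) / ∫ φ, S.indicator W φ; ∀ F G : LatticeSineGordon.Config 3 N k → ℝ, Obs F → Obs G → ∀ n : ℕ, n₀ < n → 2 * n < N → |Ef (fun φ => F φ * G (fun p => φ (p.1 + Pi.single 0 (n : ZMod N), p.2))) - Ef F * Ef (fun φ => G (fun p => φ (p.1 + Pi.single 0 (n : ZMod N), p.2)))| ≤ C * Real.exp (-(c * n))) → ∀ (k M : ℕ) (α : Fin M → Fin k → ℝ), (∀ v : Fin k → ℝ, (∀ r : Fin M, ∑ a : Fin k, α r a * v a = 0) → v = 0) → (∃ b : Fin k → Fin k → ℝ, LinearIndependent ℝ b ∧ ∀ (j : Fin k) (r : Fin M), ∃ z : ℤ, ∑ a : Fin k, α r a * b j a = 2 * Real.pi * z) → ∀ g₁ g₂ : ℝ, 0 < g₁ → g₁ ≤ g₂ → ∃ ζ₀ : ℝ, 0 < ζ₀ ∧ ∀ ζ₁ : ℝ, 0 < ζ₁ → ζ₁ ≤ ζ₀ →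 ∀ R₀ : ℕ, ∃ C c : ℝ, 0 < c ∧ ∃ n₀ : ℕ, ∀ (N : ℕ) [NeZero N], ∃ ε₀ : ℝ, 0 < ε₀ ∧ ∀ g ζ ε : ℝ, g₁ ≤ g → g ≤ g₂ → ζ₁ ≤ ζ → ζ ≤ ζ₀ → 0 < ε → ε ≤ ε₀ → let Obs := fun F : LatticeSineGordon.Config 3 N k → ℝ => Measurable F ∧ (∀ φ, |F φ| ≤ 1) ∧ (∀ φ ψ : LatticeSineGordon.Config 3 N k, (∀ x : TorusSite 3 N, (∀ i : Fin 3, (x i).val ≤ R₀) → ∀ a : Fin k, φ (x, a) = ψ (x, a)) → F φ = F ψ) ∧ (∀ (φ : LatticeSineGordon.Config 3 N k) (x : TorusSite 3 N) (w : Fin k → ℝ), (∀ r : Fin M, ∃ z : ℤ, ∑ a : Fin k, α r a * w a = 2 * Real.pi * z) → F (fun p => if p.1 = x then φ p + w p.2 else φ p) = F φ); ∀ F G : LatticeSineGordon.Config 3 N k → ℝ, Obs F → Obs G → ∀ n : ℕ, n₀ < n → 2 * n < N → |LatticeSineGordon.truncCorr α g ε ζ F (fun φ => G (fun p => φ (p.1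 + Pi.single 0 (n : ZMod N), p.2)))| ≤ C * Real.exp (-(c * n)) := by
  intro hX k M α hspan hbex g₁ g₂ hg₁ hg₁₂
  obtain ⟨b, hb, hcomm⟩ := hbex
  obtain ⟨ζ₀, hζ₀, hX1⟩ := hX k M α hspan b hb hcomm g₁ g₂ hg₁ hg₁₂
  refine ⟨ζ₀, hζ₀, fun ζ₁ hζ₁ hζ₁₀ R₀ => ?_⟩
  obtain ⟨C, c, hc, n₀, hN⟩ := hX1 ζ₁ hζ₁ hζ₁₀ R₀
  refine ⟨2 * max C 1, c, hc, n₀, fun N _ => ?_⟩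
  obtain ⟨ε₀, hε₀, hmain⟩ := hN N
  -- precision of the fixed-volume comparison at this `N`
  set Cp : ℝ := max C 1 with hCp
  have hCp1 : 1 ≤ Cp := le_max_right _ _
  have hCCp : C ≤ Cp := le_max_left _ _
  set δN : ℝ := min 1 (Cp / 4 * Real.exp (-(c * N / 2))) with hδN
  have hδNpos : 0 < δN := lt_min one_pos (by positivity)
  have hδN1 : δN ≤ 1 := min_le_left _ _
  have hδNexp : 4 * δN ≤ Cp * Real.exp (-(c * N / 2)) := by
    have := min_le_right 1 (Cp / 4 * Real.exp (-(c * N / 2)))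
    rw [← hδN] at this
    linarith
  obtain ⟨a₀, ha₀, hMc⟩ := expect_sub_flatExpect_le k b hb δN hδNpos
  set V : ℝ := (Fintype.card (TorusSite 3 N) : ℝ) with hV
  have hVpos : 0 < V := by
    rw [hV]; exact_mod_cast Fintype.card_pos
  refine ⟨min ε₀ (a₀ * g₁ ^ 2 / V), lt_min hε₀ (by positivity), ?_⟩
  intro g ζ ε hg₁g hgg₂ hζ₁ζ hζζ₀ hε hεε₀ Obs F G hF hG n hn₀ h2n
  have hgpos : 0 < g := lt_of_lt_of_le hg₁ hg₁g
  have hg : g ≠ 0 := hgpos.ne'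
  have hεε₀' : ε ≤ ε₀ := hεε₀.trans (min_le_left _ _)
  have hεV : ε * Fintype.card (TorusSite 3 N) ≤ a₀ * g ^ 2 := by
    have h1 : ε ≤ a₀ * g₁ ^ 2 / V := hεε₀.trans (min_le_right _ _)
    rw [le_div_iff₀ hVpos] at h1
    have h2 : g₁ ^ 2 ≤ g ^ 2 := pow_le_pow_left₀ hg₁.le hg₁g 2
    calc ε * Fintype.card (TorusSite 3 N) = ε * V := by rw [hV]
      _ ≤ a₀ * g₁ ^ 2 := h1
      _ ≤ a₀ * g ^ 2 := mul_le_mul_of_nonneg_left h2 ha₀.le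
  -- the flat-reference clustering bound
  have key := hmain g ζ ε hg₁g hgg₂ hζ₁ζ hζζ₀ hε hεε₀' F G hF hG n hn₀ h2n
  obtain ⟨hFm, hF1, hFloc, hFper⟩ := hF
  obtain ⟨hGm, hG1, hGloc, hGper⟩ := hG
  -- the lattice vectors `Σ_j m_j b_j` are dual to the charges
  have hwdual : ∀ (m : Fin k → ℤ) (r : Fin M), ∃ z : ℤ,
      ∑ a, α r a * (fun a => ∑ j, (m j : ℝ) * b j a) a = 2 * Real.pi * z := by
    intro m r
    choose z hz using fun j => hcomm j r
    refine ⟨∑ j, m j * z j, ?_⟩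
    calc ∑ a, α r a * (fun a => ∑ j, (m j : ℝ) * b j a) a = ∑ j, (m j : ℝ) * ∑ a, α r a * b j a := by
          simp only [mul_sum]
          rw [sum_comm]
          exact sum_congr rfl fun j _ => sum_congr rfl fun a _ => by ring
      _ = ∑ j, (m j : ℝ) * (2 * Real.pi * z j) := sum_congr rfl fun j _ => by rw [hz j]
      _ = 2 * Real.pi * ((∑ j, m j * z j : ℤ) : ℝ) := by
          push_cast
          rw [mul_sum]
          exact sum_congr rfl fun j _ => by ring
  -- the three observables entering `truncCorr`, and their admissibility for M-c
  set Gτ : LatticeSineGordon.Config 3 N k → ℝ :=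
    fun φ => G (fun p => φ (p.1 + Pi.single 0 (n : ZMod N), p.2)) with hGτ
  have hGτm : Measurable Gτ := measurable_comp_translate 3 N k (Pi.single 0 (n : ZMod N)) G hGm
  have hGτ1 : ∀ φ, |Gτ φ| ≤ 1 := fun φ => hG1 _
  have hFper' : ∀ (φ : LatticeSineGordon.Config 3 N k) (m : Fin k → ℤ),
      F (fun p => φ p + ∑ j : Fin k, (m j : ℝ) * b j p.2) = F φ := fun φ m =>
    obs_add_dual 3 N k M α F hFper φ (fun a => ∑ j, (m j : ℝ) * b j a) (hwdual m)
  have hGper' : ∀ (φ : LatticeSineGordon.Config 3 N k) (m : Fin k → ℤ),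
      G (fun p => φ p + ∑ j : Fin k, (m j : ℝ) * b j p.2) = G φ := fun φ m =>
    obs_add_dual 3 N k M α G hGper φ (fun a => ∑ j, (m j : ℝ) * b j a) (hwdual m)
  have hGτper : ∀ (φ : LatticeSineGordon.Config 3 N k) (m : Fin k → ℤ),
      Gτ (fun p => φ p + ∑ j : Fin k, (m j : ℝ) * b j p.2) = Gτ φ := fun φ m =>
    hGper' (fun p => φ (p.1 + Pi.single 0 (n : ZMod N), p.2)) m
  have hFGm : Measurable (fun φ => F φ * Gτ φ) := hFm.mul hGτm
  have hFG1 : ∀ φ, |F φ * Gτ φ| ≤ 1 := fun φ => by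
    rw [abs_mul]
    calc |F φ| * |Gτ φ| ≤ 1 * 1 := mul_le_mul (hF1 φ) (hGτ1 φ) (abs_nonneg _) zero_le_one
      _ = 1 := one_mul 1
  have hFGper : ∀ (φ : LatticeSineGordon.Config 3 N k) (m : Fin k → ℤ),
      (fun φ => F φ * Gτ φ) (fun p => φ p + ∑ j : Fin k, (m j : ℝ) * b j p.2) = F φ * Gτ φ := fun φ m => by
    beta_reduce
    rw [hFper' φ m, hGτper φ m]
  -- the fixed-volume comparisons (M-c)
  have e1 := hMc 3 N (Fin M) α hcomm g ε ζ hg hε hεV (fun φ => F φ * Gτ φ) hFGm hFG1 hFGper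
  have e2 := hMc 3 N (Fin M) α hcomm g ε ζ hg hε hεV F hFm hF1 hFper'
  have e3 := hMc 3 N (Fin M) α hcomm g ε ζ hg hε hεV Gτ hGτm hGτ1 hGτper
  have hEF : |LatticeSineGordon.expect α g ε ζ F| ≤ 1 :=
    LatticeSineGordon.abs_expect_le (d := 3) (N := N) α hg hε ζ hFm.aestronglyMeasurable hF1
  have hEG : |LatticeSineGordon.expect α g ε ζ Gτ| ≤ 1 :=
    LatticeSineGordon.abs_expect_le (d := 3) (N := N) α hg hε ζ hGτm.aestronglyMeasurable hGτ1
  -- rates: `e^{-cN/2} ≤ e^{-cn}` for `2n < N`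
  have hexp : Real.exp (-(c * N / 2)) ≤ Real.exp (-(c * n)) := by
    refine Real.exp_le_exp.2 ?_
    have h2n' : (2 * n : ℝ) < N := by exact_mod_cast h2n
    nlinarith
  have hB4 : 4 * δN ≤ Cp * Real.exp (-(c * n)) :=
    hδNexp.trans (mul_le_mul_of_nonneg_left hexp (by linarith))
  have hKB : C * Real.exp (-(c * n)) ≤ Cp * Real.exp (-(c * n)) :=
    mul_le_mul_of_nonneg_right hCCp (Real.exp_pos _).le
  have final := glue_arith _ _ _ _ _ _ δN (C * Real.exp (-(c * n))) (Cp * Real.exp (-(c * n)))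
    e1 e2 e3 hEF hEG key hδNpos.le hδN1 hKB hB4
  unfold LatticeSineGordon.truncCorr
  calc _ ≤ 2 * (Cp * Real.exp (-(c * n))) := final
    _ = 2 * max C 1 * Real.exp (-(c * n)) := by rw [hCp]; ring

end Summit.QuantumFields.YangMills.Theorems.AnchorGap

end
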